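import Summits.ResolutionOfSingularities.ResolutionOfSingularities.Theorems.PurelyInseparableDim4ResConeCInfSecondTschirnhausPrime
import Summits.ResolutionOfSingularities.ResolutionOfSingularities.Theorems.PurelyInseparableDim4ResConeCInfSecondTschirnhausFramePrime
import Summits.ResolutionOfSingularities.ResolutionOfSingularities.Theorems.PurelyInseparableDim4ResConeCInfFrameEntryPrime
import HarnessLib
import HarnessLib.Audit.Tags

/-!
# Purely inseparable four-folds — THE C∞ VIRTUAL ENTRY FOR EVERY PRIME, GIVEN A FLAGGED ROW (ENTRY-3 of the power-cone
# light-pair line «light pair of TAIL(p, p−1, 3) ∀ p»): from a FRAMED state `C₁` (ENTRY-2's output, taken by value) and a ROW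
# `(eu, ef)`, `eu + ef = d − 2`, whose FLAG `coeff_{r + λ + μ + (eu+1)u + ef·f} C₁.F` is NON-ZERO, a virtual state
# `B₀ = clean (tsch u ψ C₁)` with the window's frame — order `d + 2`, `r = x_λx_μ ∣ F`, straight, exact ledger, DEAD ROW
# `(eu, ef)` below any jet `N`, flag kept, isolated, `e_G = 3` — and the relation `B₀.F = clean (aeval θ G)`,
# `θ = tsch u ψ ∘ tsch f Φ`, to the polynomial `G` that `C₁` re-presents (cell `res-dim4-pi`, K2(p) lane, rung 1; the `(5,4)`
# instance — row `(2, 0)` — is steps (5)–(6) of res-dim4-p-3 g4's `ResCone.exists_cInf_virtual_entry`, `…ResConeCInfVirtualEntry`)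

[OURS · counted 0 · cell `res-dim4-pi` · K2(p) lane (holder res-dim4-p-12 g5, line booked g5-2 (6)); the second Tschirnhaus
for every row is res-dim4-typ-1 g5's `ResCone.exists_second_tschirnhaus_row_prime` (`…CInfSecondTschirnhausPrime` p714919)
with the support dress `row_support_of_coeff` (`…CInfSecondTschirnhausFramePrime` p715023), imported by name; seat
res-dim4-p-3 g5.]  Nothing here proves K2(p) for any `p`, any TAIL(p, p−1, 3), any TAIL(7, d, e), `NoIsolatedTrap p p`, the
Cossart–Jannsen–Saito theorem or resolution of singularities in dimension ≥ 4 / characteristic `p` — NOT proved.  AI kernel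
work, weaker than expert review.  ENTRY bookkeeping: kills nothing by itself.

**`exists_cInf_virtual_entry_of_framed_prime`** (`d + 1 = p`, `2 ≤ d`; letters `λ, μ, u, f`; row `eu + ef = d − 2`).  INPUT
BY VALUE: a state `C₁` and an `f`-datum `Φ` (`f ∉ vars Φ`, `Φ(0) = 0`) with `C₁.F = clean (tsch f Φ G)` for some polynomial
`G` (in the line: `G = A.F` the real child, or `A₁.F` a virtual slot child — ENTRY-2 / ENTRY-4), order `d + 2`,
`C₁.r = x_λx_μ ∣ C₁.F`, straight `resForm C₁ = a·x_f^d` (`a ≠ 0`), the exact pair-ledger support form, `IsIsolated p C₁.F`,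
`e_G = 3`, AND THE FLAG OF THE ROW `coeff_{C₁.r + λ + μ + (eu+1)u + ef·f} C₁.F ≠ 0`.  OUTPUT for every jet `N`: `B₀, θ` with
`θ λ = x_λ`, `θ μ = x_μ`, `θ u (0) = θ f (0) = 0`, free tangent block of determinant `≠ 0` (unipotent),
`B₀.F = clean (aeval θ G)`, and the frame of `B₀`: order `d + 2`, `r = x_λx_μ ∣ F`, `resForm = a·x_f^d`, exact ledger, NO
monomial of `(u, f)`-bidegree `(eu, ef)` below degree `N`, flag `≠ 0`, isolated, `e_G = 3` — the conjuncts of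
res-dim4-typ-1 g5's window `hE` (`…SwapTransportWindowResidualPrime`, row-parameter edition) with `π₀ = id`, `U = 1`, `E = 0`.
ROUTE verbatim the `p = 5` one: `exists_second_tschirnhaus_row_prime` (`(eu + 1 : K) ≠ 0` as `0 < eu + 1 < p`, jet
`M = N + d + 2`; straightness supplies the entry `coeff_{λ+μ+eu·u+ef·f} (F/x^r) = 0` — res-dim4-p-3 g5 FILE 4
`straight_readings_of_resForm_prime`; the exact ledger supplies the read-off on the `x_f^{ef}`-row since `ef ≤ d − 1`), then
cleaning commutes with substitutions (`SwapTransport.deletePthPowers_aeval_deletePthPowers`), `ordZero_clean_tsch`,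
`resForm_cleanTschState_eq` / `resForm_tschState_eq_tsch_linearPart` (`p ∤ d + 2`), `lowLedger_tsch_of_ne`,
`row_support_of_coeff`, `isIsolated_clean_tsch_iff`, `finrank_resVertex_cleanTschState`.
HONEST STATUS OF THE FLAG HYPOTHESIS: at `p = 5` (row `(2, 0)`) it is DISCHARGED by res-dim4-typ-1 g3's `cInf_uFlag_of_child`
(isolation of the child of a straight corner step pins `x_λx_μu³`); at `d ≥ 6` isolation pins NO row (Q-FLAG, bus 2026-08-29
10:47Z — OPEN: flagless framed states exist as polynomials), so the light-pair line at `d ≥ 6` is CONDITIONAL on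
«some row of the framed child is flagged».
[cite: CossartJannsenSaito2020, Thm. 3.14, Lemma 13.2] [cite: Hauser2010, §§F–G] [cite: Abhyankar1990, Lecture 26 pp. 228–229]
bears_on: LADDER-RESOLUTION:D157-DOOR2 (res-dim4-pi · K2(p) · power cones · C∞ virtual entry every prime given a flagged row).
Supports stmt-ResolutionOfSingularities-16155 (helper).
-/

set_option linter.dupNamespace false -- mandated namespace of this single-conjunct summit

noncomputable section

namespace Summit.ResolutionOfSingularities.ResolutionOfSingularities.Theorems.PIDim4

namespace ResCone

open MvPolynomial Finset FrameChange
open Literature.AlgebraicGeometry.Resolution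
open Literature.AlgebraicGeometry.Resolution.CentreBlowup
open Literature.AlgebraicGeometry.Resolution.Hauser2010
open Literature.AlgebraicGeometry.Resolution.HauserPerlega2019
open PointBlowup (translate)

variable {K : Type} [Field K]

/-- `(n : K) ≠ 0` for `0 < n < p` in characteristic `p`. [folklore] -/
theorem natCast_ne_zero_of_pos_of_lt_prime (p : ℕ) [Fact p.Prime] [CharP K p] {n : ℕ} (h0 : 0 < n) (hn : n < p) :
    ((n : ℕ) : K) ≠ 0 := fun h =>
  Nat.not_dvd_of_pos_of_lt h0 hn ((CharP.cast_eq_zero_iff K p n).mp h)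

/-- **THE C∞ VIRTUAL ENTRY, every prime, given a flagged row** (statement and route in the module docstring). [OURS]
[cite: CossartJannsenSaito2020, Thm. 3.14, Lemma 13.2] -/
theorem exists_cInf_virtual_entry_of_framed_prime [DecidableEq K] (p : ℕ) [hp : Fact p.Prime] [CharP K p] {d : ℕ}
    (hdp : d + 1 = p) (hd2 : 2 ≤ d) {eu ef : ℕ} (hef : eu + ef = d - 2) {la mu u f : Fin 4} (hlm : la ≠ mu) (hlu : la ≠ u)
    (hlf : la ≠ f) (hmu : mu ≠ u) (hmf : mu ≠ f) (huf : u ≠ f) {C₁ : State K} {G Φ : MvPolynomial (Fin 4) K}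
    (hΦvars : f ∉ Φ.vars) (hΦ0 : constantCoeff Φ = 0) (hC₁F : C₁.F = deletePthPowers p (tsch f Φ G))
    (hoC₁ : ordZero C₁.F = ((d + 2 : ℕ) : ℕ∞)) (hrC₁ : C₁.r = Finsupp.single la 1 + Finsupp.single mu 1)
    (hdivC₁ : ∀ e ∈ C₁.F.support, C₁.r ≤ e) {a : K} (ha : a ≠ 0) (hresC₁ : resForm C₁ = C a * X f ^ d)
    (hledC₁ : ∀ e ∈ C₁.F.support, e f ≤ d - 1 → 2 ≤ e la ∧ 2 ≤ e mu) (hisoC₁ : IsIsolated p C₁.F)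
    (he3C₁ : Module.finrank K (resVertex C₁) = 3)
    (hV : coeff (C₁.r + (Finsupp.single la 1 + Finsupp.single mu 1 + Finsupp.single u (eu + 1) + Finsupp.single f ef))
      C₁.F ≠ 0) (N : ℕ) :
    ∃ (B : State K) (θ : Fin 4 → MvPolynomial (Fin 4) K),
      θ la = X la ∧ θ mu = X mu ∧ constantCoeff (θ u) = 0 ∧ constantCoeff (θ f) = 0 ∧
      coeff (Finsupp.single u 1) (θ u) * coeff (Finsupp.single f 1) (θ f) -
        coeff (Finsupp.single f 1) (θ u) * coeff (Finsupp.single u 1) (θ f) ≠ 0 ∧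
      B.F = deletePthPowers p (aeval θ G) ∧
      ordZero B.F = ((d + 2 : ℕ) : ℕ∞) ∧ B.r = Finsupp.single la 1 + Finsupp.single mu 1 ∧
      (∀ e ∈ B.F.support, B.r ≤ e) ∧
      (∃ a : K, a ≠ 0 ∧ resForm B = C a * X f ^ d) ∧
      (∀ e ∈ B.F.support, e f ≤ d - 1 → 2 ≤ e la ∧ 2 ≤ e mu) ∧
      (∀ e ∈ B.F.support, e.degree < N → ¬ (e u = eu ∧ e f = ef)) ∧
      coeff (B.r + (Finsupp.single la 1 + Finsupp.single mu 1 + Finsupp.single u (eu + 1) + Finsupp.single f ef)) B.F ≠ 0 ∧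
      IsIsolated p B.F ∧ Module.finrank K (resVertex B) = 3 := by
  have hpd : ¬ p ∣ d + 2 := not_dvd_add_two_of_succ_eq hp.out hdp
  have heK : ((eu + 1 : ℕ) : K) ≠ 0 := natCast_ne_zero_of_pos_of_lt_prime p (by omega) (by omega)
  have hrdegC₁ : C₁.r.degree = 2 := by rw [hrC₁, map_add, Finsupp.degree_single, Finsupp.degree_single]
  have hrfC₁ : C₁.r f = 0 := by
    rw [hrC₁, Finsupp.add_apply, Finsupp.single_eq_of_ne hlf.symm, Finsupp.single_eq_of_ne hmf.symm, add_zero]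
  have hruC₁ : C₁.r u = 0 := by
    rw [hrC₁, Finsupp.add_apply, Finsupp.single_eq_of_ne hlu.symm, Finsupp.single_eq_of_ne hmu.symm, add_zero]
  have hstrC₁ := straight_readings_of_resForm_prime hoC₁ hrdegC₁ hresC₁
  have hC₁clean : deletePthPowers p C₁.F = C₁.F := by rw [hC₁F]; exact PointBlowup.deletePthPowers_deletePthPowers p _
  -- (5) the second Tschirnhaus at `C₁` on the row `(eu, ef)` (res-dim4-typ-1 g5)
  obtain ⟨ψ, hψ0, hψu, hψf, hψsupp, hrowψ, hVψ, -⟩ := exists_second_tschirnhaus_row_prime (K := K) hlm hlu.symm hmu.symm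
    hlf.symm hmf.symm huf.symm (G := C₁.F.divMonomial C₁.r) (M := N + d + 2) (eu := eu) (ef := ef) heK (by omega)
    (fun n hnf hnM hn => by
      rw [coeff_divMonomial]
      by_contra hne
      have hmem := mem_support_iff.mpr hne
      have h := hledC₁ _ hmem (by rw [Finsupp.add_apply, hrfC₁, zero_add, hnf]; omega)
      rw [hrC₁] at h
      simp only [Finsupp.add_apply, Finsupp.single_eq_same, Finsupp.single_eq_of_ne hlm,
        Finsupp.single_eq_of_ne (Ne.symm hlm), add_zero, zero_add] at h
      obtain ⟨h1, h2⟩ := h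
      rcases hn with h0 | h0 <;> omega)
    (by rw [coeff_divMonomial]; exact hV)
    (by
      rw [coeff_divMonomial]
      refine hstrC₁.2 _ (by simp only [map_add, Finsupp.degree_single]; omega) fun h => ?_
      have h' := DFunLike.congr_fun h la
      rw [Finsupp.add_apply, Finsupp.add_apply, Finsupp.add_apply, Finsupp.single_eq_same, Finsupp.single_eq_of_ne hlm,
        Finsupp.single_eq_of_ne hlu, Finsupp.single_eq_of_ne hlf, Finsupp.single_eq_of_ne hlf] at h'
      omega)
    N
  -- (6) the virtual state and the substitution
  have hG : C₁.F = monomial C₁.r 1 * C₁.F.divMonomial C₁.r := (monomial_mul_divMonomial hdivC₁).symm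
  refine ⟨⟨deletePthPowers p (tsch u ψ C₁.F), C₁.r, C₁.exc⟩, fun i => tsch u ψ (tsch f Φ (X i)),
    ?_, ?_, ?_, ?_, ?_, ?_, ?_, hrC₁, ?_, ⟨_, ha, ?_⟩, ?_, ?_, ?_, ?_, ?_⟩
  · dsimp only
    rw [tsch_X_of_ne _ hlf, tsch_X_of_ne _ hlu]
  · dsimp only
    rw [tsch_X_of_ne _ hmf, tsch_X_of_ne _ hmu]
  · dsimp only
    rw [tsch_X_of_ne _ huf, tsch_X_self, map_add, constantCoeff_X, zero_add, hψ0]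
  · dsimp only
    rw [tsch_X_self, map_add, tsch_X_of_ne _ huf.symm, map_add, constantCoeff_X, zero_add, constantCoeff_tsch hψ0, hΦ0]
  · -- the free tangent block is unipotent
    have hψu1 : coeff (Finsupp.single u 1) ψ = 0 := by
      by_contra h
      have := (hψsupp _ (mem_support_iff.mpr h)).1
      rw [Finsupp.single_eq_same] at this
      exact one_ne_zero this
    have hψf1 : coeff (Finsupp.single f 1) ψ = 0 := by
      by_contra h
      have := (hψsupp _ (mem_support_iff.mpr h)).2.1
      rw [Finsupp.single_eq_same] at this
      exact one_ne_zero this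
    have hΦf1 : coeff (Finsupp.single f 1) (tsch u ψ Φ) = 0 := by
      by_contra h
      obtain ⟨b, hb, hbf, -⟩ := exists_of_mem_support_tsch huf hψ0 hψf Φ (mem_support_iff.mpr h)
      rw [Finsupp.single_eq_same] at hbf
      have := (FrameChange.not_mem_vars_iff f Φ).mp hΦvars b hb
      omega
    have hfu : coeff (Finsupp.single f 1) (X u : MvPolynomial (Fin 4) K) = 0 := by
      rw [coeff_X, if_neg]
      intro h
      have := DFunLike.congr_fun h f
      rw [Finsupp.single_eq_same, Finsupp.single_eq_of_ne huf.symm] at this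
      omega
    have huf' : coeff (Finsupp.single u 1) (X f : MvPolynomial (Fin 4) K) = 0 := by
      rw [coeff_X, if_neg]
      intro h
      have := DFunLike.congr_fun h u
      rw [Finsupp.single_eq_same, Finsupp.single_eq_of_ne huf] at this
      omega
    dsimp only
    rw [tsch_X_of_ne _ huf, tsch_X_self, tsch_X_self, map_add, tsch_X_of_ne _ huf.symm, coeff_add, coeff_add, coeff_add,
      coeff_add, coeff_X_same, coeff_X_same, hfu, huf', hψu1, hψf1, hΦf1]
    norm_num
  · -- the relation: cleaning commutes with the substitutions
    show deletePthPowers p (tsch u ψ C₁.F) = deletePthPowers p (aeval (fun i => tsch u ψ (tsch f Φ (X i))) G)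
    have hcomp : (aeval (fun i => tsch u ψ (tsch f Φ (X i))) : MvPolynomial (Fin 4) K →ₐ[K] MvPolynomial (Fin 4) K) =
        (tsch u ψ).comp (tsch f Φ) := MvPolynomial.algHom_ext fun i => by rw [aeval_X, AlgHom.comp_apply]
    rw [hcomp, AlgHom.comp_apply, hC₁F, FrameChange.tsch, FrameChange.tsch,
      SwapTransport.deletePthPowers_aeval_deletePthPowers p]
  · rw [ordZero_clean_tsch p hψu hψ0 hC₁clean]; exact hoC₁
  · exact forall_le_of_mem_support_clean_tsch p hruC₁ hdivC₁
  · rw [resForm_cleanTschState_eq p hψu hψ0 hoC₁ hpd, resForm_tschState_eq_tsch_linearPart hψu hψ0 hruC₁ hdivC₁, hresC₁,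
      map_mul, FrameChange.tsch_C, map_pow, tsch_X_of_ne _ huf.symm]
  · intro e he hef'
    exact lowLedger_deletePthPowers p (lowLedger_tsch_of_ne hlu.symm hmu.symm huf ψ (d := d) (ra := 2) (ra' := 2)
      (fun e he hef' => hledC₁ e he (by omega))) e he (by omega)
  · intro e he heN
    rw [hG, tsch_monomial_mul ψ hruC₁] at he
    have he' := mem_support_of_mem_support_deletePthPowers p he
    exact row_support_of_coeff hruC₁ hrfC₁ (B := N) (eu := eu) (ef := ef)
      (fun m h1 h2 h3 => hrowψ m h1 h2 (by omega) (by omega)) he' (by rw [hrdegC₁]; omega)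
  · show coeff (C₁.r + _) (deletePthPowers p (tsch u ψ C₁.F)) ≠ 0
    rw [hG, tsch_monomial_mul ψ hruC₁, coeff_deletePthPowers, if_neg, coeff_monomial_mul', if_pos le_self_add,
      add_tsub_cancel_left, one_mul, hVψ, coeff_divMonomial]
    · exact hV
    · refine not_isPthPowerExponent_of_not_dvd (i := u) ?_
      simp only [Finsupp.add_apply, hruC₁, Finsupp.single_eq_same, Finsupp.single_eq_of_ne hlu.symm,
        Finsupp.single_eq_of_ne hmu.symm, Finsupp.single_eq_of_ne huf, zero_add, add_zero]
      exact Nat.not_dvd_of_pos_of_lt (by omega) (by omega)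
  · exact (isIsolated_clean_tsch_iff p hψu hψ0 _).mpr hisoC₁
  · exact (finrank_resVertex_cleanTschState p hψu hψ0 hruC₁ hdivC₁ hoC₁ hpd).trans he3C₁

end ResCone

end Summit.ResolutionOfSingularities.ResolutionOfSingularities.Theorems.PIDim4

end
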